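import Literature.IUT.LogThetaLattice.MultiradialityRemarks
import Mathlib.GroupTheory.Perm.Basic
import Mathlib.Data.ZMod.Basic
import HarnessLib

/-!
# [IUTchIII] §2 remark schemas of `MultiradialityRemarks.lean`: universal closures are false

Companion of `RemarkSchemaClosures.lean` (which treats `Rmk232_numberFieldAnalogue`, F-2071).  The three
remaining `def … : Prop` transcriptions of REMARKS in `MultiradialityRemarks.lean` (p404906) quantify over
FREE carriers / sets / type-valued maps; each is meaningful only AT A NAMED INSTANCE.  The kernel
certificates below record that the universal closure of each is FALSE (by a trivial instantiation) and
that a trivial instance is TRUE — so no file may bind the closed form as a "named fact" (abc-iut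
FACT-LIST rows F-2070 `Rmk211iv_contrast`, F-1785 `Rmk212ii_normalizerQuotient`: instance-only; the
kernel-DAG index `N_IUTchIII_Rmk2_4_2_vi` = `Rmk242vi_commonContainer` likewise).  For Rmk 2.1.1 (iv) the
trivial instance also shows that the typed "contrast" (a single isomorphism vs a `ℤ̂^×`-orbit) does not by
itself force the orbit side to be non-trivial.  HONEST FRAMING: bookkeeping about the typing of expository
remarks (RQ7 audit of p404906 by abc-iut-w5-d028); nothing here bears on the mathematics of [IUTchIII]
§2–§3 or on Cor. 3.12; no side taken.  typed ≠ proved.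
-/

namespace Literature.IUT.LogThetaLattice

namespace MultiradialityRemarks

/-- [IUTchIII] Rmk 2.1.1 (iv) schema `Rmk211iv_contrast Units monoThetaRecovered mlfRecovered`
(`(∃ e, monoThetaRecovered = {e}) ∧ ∃ e, mlfRecovered = orbit e`): its universal closure over the two
free sets is FALSE — type the mono-theta side as `∅`.
[cite: Mochizuki2012, IUTchIII Rmk 2.1.1 (iv) p.62 l.43 – p.63 l.19] -/
theorem not_forall_Rmk211iv_contrast :
    ¬ ∀ (A B : Set (Unit ≃ Unit)), Rmk211iv_contrast (Equiv.Perm Unit) A B := by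
  intro h
  obtain ⟨⟨e, he⟩, -⟩ := h ∅ ∅
  exact (Set.singleton_nonempty e).ne_empty he.symm

/-- [IUTchIII] Rmk 2.1.1 (iv): a trivial instance of `Rmk211iv_contrast` is TRUE (trivial group acting on
`Unit ≃ Unit`, both recovered sets the singleton of the identity).
[cite: Mochizuki2012, IUTchIII Rmk 2.1.1 (iv) p.62 l.43 – p.63 l.19] -/
theorem Rmk211iv_contrast_trivial :
    Rmk211iv_contrast (Equiv.Perm Unit) ({Equiv.refl Unit} : Set (Unit ≃ Unit))
      (MulAction.orbit (Equiv.Perm Unit) (Equiv.refl Unit)) :=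
  ⟨⟨_, rfl⟩, ⟨_, rfl⟩⟩

/-- … and at that instance the `ℤ̂^×`-orbit side is itself a SINGLETON: the typed contrast records the
SHAPE "single iso vs orbit" only; non-triviality of the orbit is not part of the decl.
[cite: Mochizuki2012, IUTchIII Rmk 2.1.1 (iv) p.62 l.43 – p.63 l.19] -/
theorem Rmk211iv_contrast_trivial_orbit_eq_singleton :
    MulAction.orbit (Equiv.Perm Unit) (Equiv.refl Unit) = {Equiv.refl Unit} := by
  ext x
  simp only [Set.mem_singleton_iff]
  constructor
  · intro _; exact Subsingleton.elim _ _
  · rintro rfl; exact MulAction.mem_orbit_self _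

/-- [IUTchIII] Rmk 2.1.2 (ii) schema `Rmk212ii_normalizerQuotient PiDagger ZhatModZ`
(`Nonempty (N(Π†)/Π† ≃* ZhatModZ)` over a FREE subgroup and a FREE target group): its universal closure is
FALSE — trivial ambient group, two-element target.
[cite: Mochizuki2012, IUTchIII Rmk 2.1.2 (ii) p.64 l.22 – p.65 l.5] -/
theorem not_forall_Rmk212ii_normalizerQuotient :
    ¬ ∀ (PiDagger : Subgroup (Equiv.Perm Unit)) (Z : Type) [Group Z],
        Rmk212ii_normalizerQuotient PiDagger Z := by
  intro h
  obtain ⟨e⟩ := h ⊤ (Multiplicative (ZMod 2))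
  have hsub : ∀ a b : ((Subgroup.normalizer ((⊤ : Subgroup (Equiv.Perm Unit)) : Set (Equiv.Perm Unit))) ⧸
      (⊤ : Subgroup (Equiv.Perm Unit)).subgroupOf
        (Subgroup.normalizer ((⊤ : Subgroup (Equiv.Perm Unit)) : Set (Equiv.Perm Unit)))), a = b := by
    intro a b
    induction a using QuotientGroup.induction_on with
    | H x =>
      induction b using QuotientGroup.induction_on with
      | H y => exact congrArg _ (Subsingleton.elim x y)
  have h01 : (Multiplicative.ofAdd (1 : ZMod 2)) = (1 : Multiplicative (ZMod 2)) := by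
    have := hsub (e.symm (Multiplicative.ofAdd (1 : ZMod 2))) (e.symm 1)
    simpa using congrArg e this
  exact absurd (congrArg Multiplicative.toAdd h01) (by decide)

/-- [IUTchIII] Rmk 2.4.2 (vi) schema `Rmk242vi_commonContainer reconstruct container` ("same container"
typed as EQUALITY OF TYPES `container (reconstruct η) = container (reconstruct η')` over a FREE
`container : Data → Type`): its universal closure is FALSE — a container map separating two negative
pilot elements of `M := ℤ`.
[cite: Mochizuki2012, IUTchIII Rmk 2.4.2 (vi) p.91 l.9–37] -/
theorem not_forall_Rmk242vi_commonContainer :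
    ¬ ∀ (reconstruct : {η : ℤ // η < 0} → Bool) (container : Bool → Type),
        Rmk242vi_commonContainer reconstruct container := by
  intro h
  have key := h (fun η => decide (η.1 = -1)) (fun b => cond b Unit Empty)
    ⟨-1, by norm_num⟩ ⟨-2, by norm_num⟩
  have e : Unit = Empty := by simpa using key
  exact (cast e ()).elim

/-- [IUTchIII] Rmk 2.4.2 (vi): the instance with a CONSTANT container (the intended reading: one ordered
group `M = Pic(*𝒞^⊩)` for all negative pilot elements) is TRUE, definitionally.
[cite: Mochizuki2012, IUTchIII Rmk 2.4.2 (vi) p.91 l.9–37] -/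
theorem Rmk242vi_commonContainer_const (M : Type) [AddCommGroup M] [PartialOrder M]
    (Data : Type) (reconstruct : {η : M // η < 0} → Data) (C : Type) :
    Rmk242vi_commonContainer reconstruct (fun _ => C) :=
  fun _ _ => rfl

end MultiradialityRemarks

end Literature.IUT.LogThetaLattice
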